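import Summits.Ventures.CertifiedManyBodySolver.Statement
import Summits.Ventures.CertifiedManyBodySolver.Certificates.HubbardChain_n1_row123
import Summits.Ventures.CertifiedManyBodySolver.Certificates.HubbardChain_n1_umps_c2_chi256
import HarnessLib
import HarnessLib.Audit

/-!
# Ventures/CertifiedManyBodySolver — Certificates/HubbardChain_n1_two_sided_U1_r123.lean

HONEST FRAMING: first certified bounds; not a superconductivity verdict; every number certified or labelled float.

HALF-FILLED Hubbard chain (`n = 1`, `t = 1`, thermodynamic limit), `U = 1`: `M1EnergyRow 1 lo hi` pairing the best certified half-filled LOWER row #123 (m1-1 w8 R8 b4eomx ob64p8 with onebody_fill, ref-1 R1.20; Certificates/HubbardChain_n1_row123.lean) with the signed `χ = 256` uMPS UPPER row #61 (ref-2; Certificates/HubbardChain_n1_umps_c2_chi256.lean, landed) — tighter than the landed pair `m1_U1_row_r31_r61_of` (Certificates/HubbardChain_n1_two_sided_chi256.lean) by exactly the lower-edge gain 1.648e-4; the venture's tightest certified half-filled e₀ bracket at U = 1 at signature time (float context: Lieb–Wu e(1, 1) ≈ -1.04037 lies inside). The width is informative and is NOT an M1 pass.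
The theorem takes BOTH claim nodes as hypotheses — nothing here asserts a bound unconditionally. Generated by `gen_two_sided_g151.py`
(pub-mbboot-typer g151): endpoints PARSED from the one-sided theorem texts, `lo < hi` re-checked in exact arithmetic before emission.
-/

noncomputable section

namespace Summit.Ventures.CertifiedManyBodySolver.Certificates

open Literature.MathematicalPhysics.QuantumLattice
open Literature.MathematicalPhysics.QuantumLattice.ThermodynamicLimit

/-- TWO-SIDED row `M1EnergyRow 1 (-1265318145188158676504439/1208925819614629174706176) (-285965589563/274877906944)` = `(-1265318145188158676504439/1208925819614629174706176) ≤ e ≤ (-285965589563/274877906944)` (width `7628181714808090496887/1208925819614629174706176 ≈ 6.3099e-03`), PROVED from the CERTIFIED.md claim nodes of LOWER row #123 (`cert_r123_hub_chainTL_w8_U1_n1_R8b4eomx_ob64p8f`, theorem `m1_U1_lower_r123_of`) and UPPER row #61 (`cert_r61_hub1d_U1_chi256_c2`, theorem `m1_U1_upper_r61_of`); `M1EnergyRow` is the conjunction lower ∧ upper. -/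
theorem m1_U1_row_r123_r61_of (hlo : cert_r123_hub_chainTL_w8_U1_n1_R8b4eomx_ob64p8f) (hup : cert_r61_hub1d_U1_chi256_c2) : M1EnergyRow 1 (-1265318145188158676504439/1208925819614629174706176) (-285965589563/274877906944) :=
  ⟨m1_U1_lower_r123_of hlo, m1_U1_upper_r61_of hup⟩

end Summit.Ventures.CertifiedManyBodySolver.Certificates

end
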